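import Mathlib
import HarnessLib
import Summits.HubbardSuperconductivity.HubbardSuperconductivity.Theorems.KLProgrammeC4aValueBridgePVIntegral
import Summits.HubbardSuperconductivity.HubbardSuperconductivity.Theorems.KLProgrammeC4aValueBridgeLevel

/-!
# Route `KLProgramme` — crux C4a, value layer (L3-val): THE EVEN-VERTEX VALUE BRIDGE — for `V(k,q) = B(k+q)` with `B` even, `C²`, and Fréchet
# majorants `‖DB‖ ≲ max(c′‖p‖,Λ)⁻¹`, `‖D²B‖ ≲ max(c′‖p‖,Λ)⁻²`, `‖B‖ ≲ 1 + max(c′‖p‖,Λ)^{−1/2}`, the odd-difference of the angular averages is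
# LINEAR in the level with a `Λ`-FREE constant: `‖G_θ(ρ) − G_θ(−ρ)‖ ≤ D·|ρ|`

Cell `gate-hubbard-kl`, lane hubbard-kl-k3c3-p3 (g14); helper for stub (C) `stub_twoLeg_curvature` of the engine-flow child `KLRegimeEngineV17F2`
(stmt-HubbardSuperconductivity-20437), `k = 0` VALUE clause (located risk #12 «(C)-VALUE-K0»).  It supplies input (ii) (L3-val) of HOME/hubbard-kl-c4a-1/C4A-PLAN.md
§22.3 for every vertex piece of the form `B(k+q)` (pp) — and, by central symmetry, `B(k−q)` (ph-exchange) — whose `B` is EVEN with two-inverse-power majorants: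
the `hd` of `…C4aTadpoleValueAssembly.norm_sum_tubeTadpoles_le_of_oddDiff` / `norm_localReadingCont_laplacian_le_of_linear_oddDiff` with `d(ρ) = D·|ρ|`,
`D` INDEPENDENT OF THE SCALE `Λ`.  Fifth (last) file of the «(L3-val)-EVEN-BRIDGE» bundle (`…Geometry`, `…PV`, `…PVIntegral`, `…Level`).

THE THEOREM (`norm_tubeAngularAvg_pairSum_sub_neg_le`): frame sizes as in `…C4aPathJets`; `B : Momentum → ℂ`, `ContDiff ℝ 2 B`, `B(−p) = B(p)`,
`‖B p‖ ≤ cb₀ + cbh·(max(c′‖p‖,Λ))^{−1/2}`, `‖DB p‖ ≤ cb₁·(max(c′‖p‖,Λ))⁻¹`, `‖D²B p‖ ≤ cb₂·(max(c′‖p‖,Λ))⁻²` (`0 < c′, Λ`; `cbh, cb₁, cb₂ ≥ 0`); then for `|s| < r` and every `θ`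
  `‖tubeAngularAvg μ K (k,q ↦ B(k+q)) θ s − tubeAngularAvg μ K (k,q ↦ B(k+q)) θ (−s)‖ ≤ (2·jacR·Cval + 2·valuePVConst A A₃ A₄ r cb₁ cb₂ c′)·|s|`,
`jacR = 1/(Dt−2A)² + π√2(2+4A)/(Dt−2A)³` (k3c3-p3's radial row p573650), `Cval = 2π·cb₀ + cbh·(c′·pairSumLowerConst r)^{−1/2}·4√π`.
Proof: `G(s) − G(−s) = ∫ (J(s,·)−J(−s,·))•B(S_s) + ∫ J(−s,·)•(B(S_s) − B(S_{−s}))`; the first is `≤ 2jacR|s|·∫(cb₀ + cbh(c′c|φ|)^{−1/2})` (`…Level` §1),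
the second is `∫_φ∫_{σ=−s}^{s} DB(S_σ)[J•∂_σS_σ]` (`…Level` §3), `= ∫_σ∫_φ` (Fubini), and each inner `φ`-integral is `≤ valuePVConst` (`…PVIntegral`).
§2: the particle–hole twin (`V(k,q) = B(k−q)` has THE SAME angular average, by `Φ(ρ,ϑ+π) = −Φ(ρ,ϑ)` and the `π`-periodicity of `J`).

WHAT THIS DOES NOT COVER (located, memo HOME/hubbard-kl-k3c3-p3/L3VAL-BRIDGE.md): the frequency-odd part of the pp bubble (`𝔅(−Ω) = conj 𝔅(Ω)`), which meets the
EVEN kernel `−ω·w/(ω²+ρ²)` of `Re(ŝ·G)` and is not `ρ`-paired; and the hypothesis at `k = 2` is TWO inverse powers — under the one-power form of C4A-PLAN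
§23.3 (d3) the linear law is false (`B_Λ(p) = Λ·logcosh(p·ν/Λ)/‖p‖`).  Nothing here asserts anything about the Hubbard model's bubbles; nothing asserts superconductivity.
References: BGM 2006 §2.4 (2.36), Lemma 2.1 [cite: BenfattoGiulianiMastropietro2006]; FST II CPAM 51 (1998) §3.
-/

noncomputable section

namespace Summit.HubbardSuperconductivity.HubbardSuperconductivity.Theorems.C4a

set_option linter.dupNamespace false -- summit = problem name (single-conjunct summit), D-0017

open Real Set MeasureTheory Filter
open scoped ContDiff Topology
open Literature.MathematicalPhysics.QuantumLattice Literature.MathematicalPhysics.QuantumLattice.BandSectorCounting Literature.Probability.LatticeModels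
open Summit.HubbardSuperconductivity.HubbardSuperconductivity.Theorems.KLRegimeSplit
open Summit.HubbardSuperconductivity.HubbardSuperconductivity.Theorems.DispersionFlow
open Summit.HubbardSuperconductivity.HubbardSuperconductivity.Theorems.PerturbedFermiCurve

section Sizes

variable {K : TrigPolyC4v} {A : ℝ} (hA : ∀ p : Momentum, ∀ j ≤ 2, ‖iteratedFDeriv ℝ j (frameShift K) p‖ ≤ A) (hA20 : A ≤ 1 / 20)
  (hd : klCurveD ≤ (bandBounds (show (-4 : ℝ) < -1.1 by norm_num) (show (-1.1 : ℝ) ≤ -0.1 by norm_num)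
    (show (-0.1 : ℝ) < 0 by norm_num)).Dtmin - 2 * A)
  {μ r : ℝ} (hr : 0 < r) (hlo : (-1.1 : ℝ) < μ - r - A) (hhi : μ + r + A < -0.1)
  {A₃ A₄ : ℝ} (hA₃ : ∀ p : Momentum, ‖iteratedFDeriv ℝ 3 (frameShift K) p‖ ≤ A₃)
  (hA₄ : ∀ p : Momentum, ‖iteratedFDeriv ℝ 4 (frameShift K) p‖ ≤ A₄)
include hA hA20 hd hr hlo hhi hA₃ hA₄

/-! ## §1 The even-vertex value bridge -/

omit hA20 hA₃ hA₄ hr in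
/-- The recentred chart-side integrand `φ ↦ J(ρ, π+φ+θ) • B(S_{ρ,π+φ,θ}(0))` is continuous (`|ρ| < r`, `B` continuous). -/
theorem continuous_jac_smul_apply_pairSumPath {Bf : Momentum → ℂ} (hB : Continuous Bf) {ρ : ℝ} (hρ : |ρ| < r) (θ : ℝ) :
    Continuous fun φ : ℝ => levelChartJac μ K (ρ, π + φ + θ) • Bf (pairSumPath μ K ρ (π + φ) θ 0) := by
  set B := bandBounds (show (-4 : ℝ) < -1.1 by norm_num) (show (-1.1 : ℝ) ≤ -0.1 by norm_num) (show (-0.1 : ℝ) < 0 by norm_num) with hBdef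
  have hADt : 2 * A < B.Dtmin := by have := klCurveD_pos; linarith
  have hρI : ρ ∈ Ioo (-r) r := ⟨(abs_lt.1 hρ).1, (abs_lt.1 hρ).2⟩
  have hJ := (continuous_levelChartJac_angle B hA hADt hlo hhi hρI).comp (by fun_prop : Continuous fun φ : ℝ => π + φ + θ)
  exact (by simpa [Function.comp_def] using hJ : Continuous fun φ : ℝ => levelChartJac μ K (ρ, π + φ + θ)).smul
    (hB.comp (continuous_pairSumPath_pi_add hA hd hlo hhi hρ θ))

/-- **The value majorant along a level curve**: if `‖B p‖ ≤ cb₀ + cbh·(max(c′‖p‖,Λ))^{−1/2}` then, for `|ρ| < r`, `φ ∈ (−π,π)`, `φ ≠ 0`,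
`‖B(S_{ρ,π+φ,θ}(0))‖ ≤ cb₀ + cbh·(c′·pairSumLowerConst r)^{−1/2}·|φ|^{−1/2}`. -/
theorem norm_apply_pairSumPath_le_of_valueMajorant {Bf : Momentum → ℂ} {cb₀ cbh c' Λ : ℝ} (hc' : 0 < c') (hcbh : 0 ≤ cbh)
    (hB0 : ∀ p, ‖Bf p‖ ≤ cb₀ + cbh * (max (c' * ‖p‖) Λ) ^ (-(1 / 2 : ℝ))) {ρ : ℝ} (hρ : |ρ| < r) (θ : ℝ) {φ : ℝ} (hφ : φ ∈ Ioo (-π) π)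
    (hφ0 : φ ≠ 0) :
    ‖Bf (pairSumPath μ K ρ (π + φ) θ 0)‖ ≤ cb₀ + cbh * ((c' * pairSumLowerConst r) ^ (-(1 / 2 : ℝ)) * |φ| ^ (-(1 / 2 : ℝ))) := by
  have hc : 0 < pairSumLowerConst r := pairSumLowerConst_pos hr
  have hS := norm_pairSumPath_pi_add_ge hA hA20 hd hr hlo hhi hA₃ hA₄ hρ hφ θ
  have hφpos : 0 < |φ| := abs_pos.2 hφ0
  have hlow : c' * pairSumLowerConst r * |φ| ≤ max (c' * ‖pairSumPath μ K ρ (π + φ) θ 0‖) Λ := by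
    refine le_max_of_le_left ?_
    rw [mul_assoc]
    exact mul_le_mul_of_nonneg_left (le_trans (by nlinarith [abs_nonneg ρ, hc.le]) hS) hc'.le
  have hpow : (max (c' * ‖pairSumPath μ K ρ (π + φ) θ 0‖) Λ) ^ (-(1 / 2 : ℝ)) ≤ (c' * pairSumLowerConst r * |φ|) ^ (-(1 / 2 : ℝ)) :=
    Real.rpow_le_rpow_of_nonpos (by positivity) hlow (by norm_num)
  refine (hB0 _).trans (add_le_add le_rfl ?_)
  rw [← Real.mul_rpow (by positivity) (abs_nonneg _)]
  exact mul_le_mul_of_nonneg_left hpow hcbh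

/-- **THE EVEN-VERTEX VALUE BRIDGE (L3-val), particle–particle form.**  Frame sizes as in `…C4aPathJets`; `B : Momentum → ℂ` of class `C²`, EVEN,
with `‖B p‖ ≤ cb₀ + cbh·(max(c′‖p‖,Λ))^{−1/2}`, `‖DB p‖ ≤ cb₁·(max(c′‖p‖,Λ))⁻¹`, `‖D²B p‖ ≤ cb₂·(max(c′‖p‖,Λ))⁻²` (`0 < c′`, `0 < Λ`, `cbh, cb₁, cb₂ ≥ 0`).
Then for every base angle `θ` and level `|s| < r`:
`‖tubeAngularAvg μ K (k,q ↦ B(k+q)) θ s − tubeAngularAvg μ K (k,q ↦ B(k+q)) θ (−s)‖ ≤ (2·jacR·Cval + 2·valuePVConst A A₃ A₄ r cb₁ cb₂ c′)·|s|`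
with `jacR = 1/(Dt−2A)² + π√2(2+4A)/(Dt−2A)³`, `Cval = 2π·cb₀ + cbh·(c′·pairSumLowerConst r)^{−1/2}·4√π` — a dominator LINEAR in the level whose
constant does not see `Λ`. [cite: BenfattoGiulianiMastropietro2006, §2.4 (2.36)] -/
theorem norm_tubeAngularAvg_pairSum_sub_neg_le {Bf : Momentum → ℂ} (hB : ContDiff ℝ 2 Bf) (heven : ∀ p, Bf (-p) = Bf p)
    {cb₀ cbh cb₁ cb₂ c' Λ : ℝ} (hc' : 0 < c') (hΛ : 0 < Λ) (hcbh : 0 ≤ cbh) (hcb₁ : 0 ≤ cb₁) (hcb₂ : 0 ≤ cb₂)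
    (hB0 : ∀ p, ‖Bf p‖ ≤ cb₀ + cbh * (max (c' * ‖p‖) Λ) ^ (-(1 / 2 : ℝ))) (hD1 : ∀ p, ‖fderiv ℝ Bf p‖ ≤ cb₁ * (max (c' * ‖p‖) Λ)⁻¹)
    (hD2 : ∀ p, ‖iteratedFDeriv ℝ 2 Bf p‖ ≤ cb₂ * ((max (c' * ‖p‖) Λ) ^ 2)⁻¹) (θ : ℝ) {s : ℝ} (hs : |s| < r) :
    ‖tubeAngularAvg μ K (fun k q => Bf (k + q)) θ s - tubeAngularAvg μ K (fun k q => Bf (k + q)) θ (-s)‖ ≤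
      (2 * (1 / ((bandBounds (show (-4 : ℝ) < -1.1 by norm_num) (show (-1.1 : ℝ) ≤ -0.1 by norm_num) (show (-0.1 : ℝ) < 0 by norm_num)).Dtmin -
                2 * A) ^ 2 +
              Real.pi * Real.sqrt 2 * (2 + 4 * A) /
                ((bandBounds (show (-4 : ℝ) < -1.1 by norm_num) (show (-1.1 : ℝ) ≤ -0.1 by norm_num) (show (-0.1 : ℝ) < 0 by norm_num)).Dtmin -
                    2 * A) ^ 3) *
            (2 * π * cb₀ + cbh * (c' * pairSumLowerConst r) ^ (-(1 / 2 : ℝ)) * (4 * Real.sqrt π)) +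
          2 * valuePVConst A A₃ A₄ r cb₁ cb₂ c') * |s| := by
  set B := bandBounds (show (-4 : ℝ) < -1.1 by norm_num) (show (-1.1 : ℝ) ≤ -0.1 by norm_num) (show (-0.1 : ℝ) < 0 by norm_num) with hBdef
  have hADt : 2 * A < B.Dtmin := by have := klCurveD_pos; linarith
  have hDt : 0 < B.Dtmin - 2 * A := by linarith
  set c := pairSumLowerConst r with hcdef
  have hc : 0 < c := pairSumLowerConst_pos hr
  set jacR := 1 / (B.Dtmin - 2 * A) ^ 2 + Real.pi * Real.sqrt 2 * (2 + 4 * A) / (B.Dtmin - 2 * A) ^ 3 with hjacR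
  have hA0 : 0 ≤ A := le_trans (norm_nonneg _) (hA 0 0 (by norm_num))
  have hjacR0 : 0 < jacR := jacRadialConst_pos B hADt hA0
  set Cval := 2 * π * cb₀ + cbh * (c' * c) ^ (-(1 / 2 : ℝ)) * (4 * Real.sqrt π) with hCval
  set P := valuePVConst A A₃ A₄ r cb₁ cb₂ c' with hPdef
  -- WLOG `0 ≤ s`
  wlog hs0 : 0 ≤ s generalizing s with H
  · have h := H (s := -s) (by rwa [abs_neg]) (by linarith)
    rw [neg_neg, abs_neg, norm_sub_rev] at h
    exact h
  have hsI : s ∈ Ioo (-r) r := ⟨(abs_lt.1 hs).1, (abs_lt.1 hs).2⟩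
  have hnsI : -s ∈ Ioo (-r) r := ⟨by linarith [(abs_lt.1 hs).2], by linarith [(abs_lt.1 hs).1]⟩
  have hns : |(-s)| < r := by rwa [abs_neg]
  have hBcont : Continuous Bf := hB.continuous
  have hB1 : ContDiff ℝ 1 Bf := hB.of_le (by norm_num)
  -- the two recentred averages and their integrands
  set ϑf : ℝ → ℝ := fun φ => π + φ + θ with hϑf
  set Sv : ℝ → ℝ → Momentum := fun ρ φ => pairSumPath μ K ρ (π + φ) θ 0 with hSv
  set vel : ℝ → ℝ → Momentum := fun σ φ =>
    WithLp.toLp 2 (deriv (fun m : ℝ => perturbedFermiRadius (fun k : Fin 2 → ℝ => -K.eval k) m (π + φ + θ)) (μ + σ) • dir (π + φ + θ)) with hvel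
  have hGp := tubeAngularAvg_pairSum_eq_recentre μ K Bf θ s
  have hGm := tubeAngularAvg_pairSum_eq_recentre μ K Bf θ (-s)
  have hIp : IntegrableOn (fun φ => levelChartJac μ K (s, π + φ + θ) • Bf (Sv s φ)) (Ioo (-π) π) :=
    ((continuous_jac_smul_apply_pairSumPath hA hd hlo hhi hBcont hs θ).continuousOn.integrableOn_Icc (a := -π) (b := π)).mono_set
      Ioo_subset_Icc_self
  have hIm : IntegrableOn (fun φ => levelChartJac μ K (-s, π + φ + θ) • Bf (Sv (-s) φ)) (Ioo (-π) π) :=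
    ((continuous_jac_smul_apply_pairSumPath hA hd hlo hhi hBcont hns θ).continuousOn.integrableOn_Icc (a := -π) (b := π)).mono_set
      Ioo_subset_Icc_self
  -- T₁ integrand: (J(s) − J(−s)) • B(S_s);  T₂ integrand: J(−s) • (B(S_s) − B(S_{−s}))
  have hJs : Continuous fun φ : ℝ => levelChartJac μ K (s, π + φ + θ) :=
    by simpa [Function.comp_def] using (continuous_levelChartJac_angle B hA hADt hlo hhi hsI).comp (by fun_prop : Continuous fun φ : ℝ => π + φ + θ)
  have hJm : Continuous fun φ : ℝ => levelChartJac μ K (-s, π + φ + θ) :=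
    by simpa [Function.comp_def] using (continuous_levelChartJac_angle B hA hADt hlo hhi hnsI).comp (by fun_prop : Continuous fun φ : ℝ => π + φ + θ)
  have hBSp : Continuous fun φ : ℝ => Bf (Sv s φ) := hBcont.comp (continuous_pairSumPath_pi_add hA hd hlo hhi hs θ)
  have hBSm : Continuous fun φ : ℝ => Bf (Sv (-s) φ) := hBcont.comp (continuous_pairSumPath_pi_add hA hd hlo hhi hns θ)
  have hT1int : IntegrableOn (fun φ => (levelChartJac μ K (s, π + φ + θ) - levelChartJac μ K (-s, π + φ + θ)) • Bf (Sv s φ)) (Ioo (-π) π) :=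
    (((hJs.sub hJm).smul hBSp).continuousOn.integrableOn_Icc (a := -π) (b := π)).mono_set Ioo_subset_Icc_self
  have hT2int : IntegrableOn (fun φ => levelChartJac μ K (-s, π + φ + θ) • (Bf (Sv s φ) - Bf (Sv (-s) φ))) (Ioo (-π) π) :=
    ((hJm.smul (hBSp.sub hBSm)).continuousOn.integrableOn_Icc (a := -π) (b := π)).mono_set Ioo_subset_Icc_self
  have hsplit : tubeAngularAvg μ K (fun k q => Bf (k + q)) θ s - tubeAngularAvg μ K (fun k q => Bf (k + q)) θ (-s) =
      (∫ φ in Ioo (-π) π, (levelChartJac μ K (s, π + φ + θ) - levelChartJac μ K (-s, π + φ + θ)) • Bf (Sv s φ)) +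
        ∫ φ in Ioo (-π) π, levelChartJac μ K (-s, π + φ + θ) • (Bf (Sv s φ) - Bf (Sv (-s) φ)) := by
    rw [hGp, hGm, ← integral_sub hIp hIm, ← integral_add hT1int hT2int]
    refine setIntegral_congr_fun measurableSet_Ioo fun φ _ => ?_
    simp only [hSv, sub_smul, smul_sub]
    abel
  -- T₁: the Jacobian row against the value majorant
  have hT1 : ‖∫ φ in Ioo (-π) π, (levelChartJac μ K (s, π + φ + θ) - levelChartJac μ K (-s, π + φ + θ)) • Bf (Sv s φ)‖ ≤
      2 * jacR * Cval * s := by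
    have hmaj : IntegrableOn (fun φ : ℝ => 2 * jacR * s * (cb₀ + cbh * ((c' * c) ^ (-(1 / 2 : ℝ)) * |φ| ^ (-(1 / 2 : ℝ))))) (Ioo (-π) π) :=
      ((continuous_const.integrableOn_Icc (a := -π) (b := π) |>.mono_set Ioo_subset_Icc_self).add
        ((integrableOn_abs_rpow_neg_half.const_mul _).const_mul cbh)).const_mul _
    have hae : ∀ᵐ φ ∂(volume.restrict (Ioo (-π) π)),
        ‖(levelChartJac μ K (s, π + φ + θ) - levelChartJac μ K (-s, π + φ + θ)) • Bf (Sv s φ)‖ ≤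
          2 * jacR * s * (cb₀ + cbh * ((c' * c) ^ (-(1 / 2 : ℝ)) * |φ| ^ (-(1 / 2 : ℝ)))) := by
      have h0 : ∀ᵐ φ : ℝ, φ ≠ 0 := by
        have : (volume : Measure ℝ) {φ : ℝ | ¬ φ ≠ 0} = 0 := by simp [measure_singleton]
        exact this
      filter_upwards [ae_restrict_mem measurableSet_Ioo, ae_restrict_of_ae h0] with φ hφ hφ0
      have hJ : |levelChartJac μ K (s, π + φ + θ) - levelChartJac μ K (-s, π + φ + θ)| ≤ 2 * jacR * s := by
        have h := abs_levelChartJac_sub_le B hA hADt hlo hhi hsI hnsI (π + φ + θ)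
        rw [← hjacR, sub_neg_eq_add, ← two_mul, abs_mul, abs_two, abs_of_nonneg hs0] at h
        linarith
      have hBv := norm_apply_pairSumPath_le_of_valueMajorant hA hA20 hd hr hlo hhi hA₃ hA₄ hc' hcbh hB0 hs θ hφ hφ0
      rw [← hcdef] at hBv
      rw [norm_smul, Real.norm_eq_abs]
      exact mul_le_mul hJ hBv (norm_nonneg _) (by positivity)
    calc _ ≤ ∫ φ in Ioo (-π) π, 2 * jacR * s * (cb₀ + cbh * ((c' * c) ^ (-(1 / 2 : ℝ)) * |φ| ^ (-(1 / 2 : ℝ)))) :=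
          (norm_integral_le_integral_norm _).trans (integral_mono_ae hT1int.norm hmaj hae)
      _ = 2 * jacR * s * (cb₀ * (2 * π) + cbh * ((c' * c) ^ (-(1 / 2 : ℝ)) * (4 * Real.sqrt π))) := by
          rw [integral_const_mul, integral_add, setIntegral_const, smul_eq_mul, Real.volume_real_Ioo_of_le (by linarith [Real.pi_pos]),
            integral_const_mul, integral_const_mul, setIntegral_abs_rpow_neg_half]
          · ring
          · exact continuous_const.integrableOn_Icc (a := -π) (b := π) |>.mono_set Ioo_subset_Icc_self
          · exact (integrableOn_abs_rpow_neg_half.const_mul _).const_mul cbh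
      _ = 2 * jacR * Cval * s := by rw [hCval]; ring
  -- T₂: the level path, Fubini, and the principal-value bound at each level
  have hT2 : ‖∫ φ in Ioo (-π) π, levelChartJac μ K (-s, π + φ + θ) • (Bf (Sv s φ) - Bf (Sv (-s) φ))‖ ≤ 2 * P * s := by
    have hFTC : ∀ φ, levelChartJac μ K (-s, π + φ + θ) • (Bf (Sv s φ) - Bf (Sv (-s) φ)) =
        ∫ σ in Ioc (-s) s, (fderiv ℝ Bf (Sv σ φ)) (levelChartJac μ K (-s, π + φ + θ) • vel σ φ) := by
      intro φ
      rw [hSv, apply_pairSumPath_sub_eq_intervalIntegral B hA hADt hlo hhi hB1 hs φ θ, intervalIntegral.integral_of_le (by linarith),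
        ← integral_smul]
      refine setIntegral_congr_fun measurableSet_Ioc fun σ _ => ?_
      rw [hvel, map_smul]
    have heq : (∫ φ in Ioo (-π) π, levelChartJac μ K (-s, π + φ + θ) • (Bf (Sv s φ) - Bf (Sv (-s) φ))) =
        ∫ σ in Ioc (-s) s, ∫ φ in Ioo (-π) π, (fderiv ℝ Bf (Sv σ φ)) (levelChartJac μ K (-s, π + φ + θ) • vel σ φ) := by
      rw [← setIntegral_setIntegral_swap_levelVel B hA hADt hlo hhi hB1 hns hsI.2 θ]
      exact setIntegral_congr_fun measurableSet_Ioo fun φ _ => hFTC φ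
    rw [heq]
    have hinner : ∀ σ ∈ Ioc (-s) s, ‖∫ φ in Ioo (-π) π, (fderiv ℝ Bf (Sv σ φ)) (levelChartJac μ K (-s, π + φ + θ) • vel σ φ)‖ ≤ P := by
      intro σ hσ
      have hσ' : |σ| < r := abs_lt.2 ⟨by linarith [hσ.1, hnsI.1], by linarith [hσ.2, hsI.2]⟩
      exact norm_setIntegral_fderiv_pairSumPath_le hA hA20 hd hr hlo hhi hA₃ hA₄ hB heven hc' hΛ hcb₁ hcb₂ hD1 hD2 hns hσ' θ
    calc _ ≤ P * (volume : Measure ℝ).real (Ioc (-s) s) := norm_setIntegral_le_of_norm_le_const measure_Ioc_lt_top hinner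
      _ = 2 * P * s := by rw [Real.volume_real_Ioc_of_le (by linarith)]; ring
  -- assemble
  rw [hsplit, abs_of_nonneg hs0]
  calc _ ≤ 2 * jacR * Cval * s + 2 * P * s := (norm_add_le _ _).trans (add_le_add hT1 hT2)
    _ = (2 * jacR * Cval + 2 * P) * s := by ring

/-! ## §2 The particle–hole twin: `B(k − q)` has the same angular average -/

omit hA hA20 hd hr hlo hhi hA₃ hA₄ in
/-- **Central symmetry**: the angular average of `V(k,q) = B(k − q)` equals that of `V(k,q) = B(k + q)` (`Φ(ρ,ϑ+π) = −Φ(ρ,ϑ)`, `J(ρ,ϑ+π) = J(ρ,ϑ)`,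
shift of the periodic loop-angle integral by `π`). -/
theorem tubeAngularAvg_pairDiff_eq_pairSum (μ : ℝ) (K : TrigPolyC4v) (Bf : Momentum → ℂ) (θ ρ : ℝ) :
    tubeAngularAvg μ K (fun k q => Bf (k - q)) θ ρ = tubeAngularAvg μ K (fun k q => Bf (k + q)) θ ρ := by
  have hupi : ∀ m ϑ : ℝ, perturbedFermiRadius (fun k : Fin 2 → ℝ => -K.eval k) m (ϑ + π) = perturbedFermiRadius (fun k : Fin 2 → ℝ => -K.eval k) m ϑ :=
    fun m ϑ => perturbedFermiRadius_add_pi (δ := fun k : Fin 2 → ℝ => -K.eval k) (fun k => by simp [TrigPolyC4v.eval_neg]) m ϑ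
  have hJpi : ∀ ϑ, levelChartJac μ K (ρ, ϑ + π) = levelChartJac μ K (ρ, ϑ) := fun ϑ => by
    simp only [levelChartJac_apply, hupi]
  set F : ℝ → ℂ := fun ϑ => levelChartJac μ K (ρ, ϑ) • Bf (levelPoint μ K 0 θ + levelPoint μ K ρ ϑ) with hF
  have hper : Function.Periodic F (2 * π) := fun ϑ => by simp only [hF, levelChartJac_periodic μ K ρ ϑ, levelPoint_add_two_pi]
  rw [tubeAngularAvg_apply, tubeAngularAvg_apply]
  have h1 : (fun ϑ => levelChartJac μ K (ρ, ϑ) • Bf (levelPoint μ K 0 θ - levelPoint μ K ρ ϑ)) = fun ϑ => F (ϑ + π) := by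
    funext ϑ
    simp only [hF, hJpi, levelPoint_add_pi, sub_eq_add_neg]
  rw [h1]
  have h2 : ∫ ϑ in Ioc 0 (2 * π), F (ϑ + π) = ∫ ϑ in (0 : ℝ)..(0 + 2 * π), F (ϑ + π) := by
    rw [intervalIntegral.integral_of_le (by positivity), zero_add]
  have h3 : ∫ ϑ in Ioc 0 (2 * π), F ϑ = ∫ ϑ in (0 : ℝ)..(0 + 2 * π), F ϑ := by
    rw [intervalIntegral.integral_of_le (by positivity), zero_add]
  rw [h2, h3, intervalIntegral.integral_comp_add_right, show (0 : ℝ) + 2 * π + π = (0 + π) + 2 * π by ring]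
  exact hper.intervalIntegral_add_eq (0 + π) 0

/-- **THE EVEN-VERTEX VALUE BRIDGE, particle–hole form**: the same linear dominator for `V(k,q) = B(k − q)`. -/
theorem norm_tubeAngularAvg_pairDiff_sub_neg_le {Bf : Momentum → ℂ} (hB : ContDiff ℝ 2 Bf) (heven : ∀ p, Bf (-p) = Bf p)
    {cb₀ cbh cb₁ cb₂ c' Λ : ℝ} (hc' : 0 < c') (hΛ : 0 < Λ) (hcbh : 0 ≤ cbh) (hcb₁ : 0 ≤ cb₁) (hcb₂ : 0 ≤ cb₂)
    (hB0 : ∀ p, ‖Bf p‖ ≤ cb₀ + cbh * (max (c' * ‖p‖) Λ) ^ (-(1 / 2 : ℝ))) (hD1 : ∀ p, ‖fderiv ℝ Bf p‖ ≤ cb₁ * (max (c' * ‖p‖) Λ)⁻¹)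
    (hD2 : ∀ p, ‖iteratedFDeriv ℝ 2 Bf p‖ ≤ cb₂ * ((max (c' * ‖p‖) Λ) ^ 2)⁻¹) (θ : ℝ) {s : ℝ} (hs : |s| < r) :
    ‖tubeAngularAvg μ K (fun k q => Bf (k - q)) θ s - tubeAngularAvg μ K (fun k q => Bf (k - q)) θ (-s)‖ ≤
      (2 * (1 / ((bandBounds (show (-4 : ℝ) < -1.1 by norm_num) (show (-1.1 : ℝ) ≤ -0.1 by norm_num) (show (-0.1 : ℝ) < 0 by norm_num)).Dtmin -
                2 * A) ^ 2 +
              Real.pi * Real.sqrt 2 * (2 + 4 * A) /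
                ((bandBounds (show (-4 : ℝ) < -1.1 by norm_num) (show (-1.1 : ℝ) ≤ -0.1 by norm_num) (show (-0.1 : ℝ) < 0 by norm_num)).Dtmin -
                    2 * A) ^ 3) *
            (2 * π * cb₀ + cbh * (c' * pairSumLowerConst r) ^ (-(1 / 2 : ℝ)) * (4 * Real.sqrt π)) +
          2 * valuePVConst A A₃ A₄ r cb₁ cb₂ c') * |s| := by
  rw [tubeAngularAvg_pairDiff_eq_pairSum, tubeAngularAvg_pairDiff_eq_pairSum]
  exact norm_tubeAngularAvg_pairSum_sub_neg_le hA hA20 hd hr hlo hhi hA₃ hA₄ hB heven hc' hΛ hcbh hcb₁ hcb₂ hB0 hD1 hD2 θ hs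

end Sizes

end Summit.HubbardSuperconductivity.HubbardSuperconductivity.Theorems.C4a

end
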